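import Literature.NumberTheory.FaltingsSerre.TypeGCriterion
import HarnessLib

/-!
# The integer criterion for type (G) is sharp: the four inequalities are also necessary

`TypeGCriterion.lean` proves that for `p > 0` and integers `a, b` with
`a² − 4b + 8p ≥ 0`, `a² ≤ 16p`, `2p + b ≥ 0`, `4a²p ≤ (2p + b)²`, every complex root `z` of the
surface-shaped polynomial `Q(T) = 1 − aT + bT² − paT³ + p²T⁴` (`lPolynomialOfSurface p a b`) has
`|z| = p^{−1/2}` — the type-(G) hypothesis of [BPPTVY, Prop 4.3.2 p. 1168; Thm 4.3.4 p. 1169] at `p`.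
This file proves the CONVERSE (`ineq_of_typeG`) and packages the equivalence (`typeG_iff_ineq`): so the
binder `hG` of the cited fact `BrumerEtAl2019.existsIntegralSymplecticGaloisRep_two_primeLevel` /
`paramodular_of_galoisCertificate_cited` at a prime `p₀` is EXACTLY a decidable condition on the two
integers `(a_{p₀}(f), b_{p₀}(f))`.  Proof: with `y = pz + 1/z` one has `Q(z) = z²(y² − ay + b − 2p)`;
every root `y` of `y² − ay + b − 2p` is hit by a root `z` of `Q` (solve `pz² − yz + 1 = 0`), and
`|z|² = 1/p` forces `1/z = p z̄`, so `y = 2p·Re z` is real with `y² ≤ 4p`; writing the two roots as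
`y₁ + y₂ = a`, `y₁y₂ = b − 2p` gives `a² − 4b + 8p = (y₁ − y₂)² ≥ 0`, `a² ≤ 2(y₁² + y₂²) ≤ 16p`,
`2p + b = y₁y₂ + 4p ≥ 0` and `(2p + b)² − 4a²p = (4p − y₁²)(4p − y₂²) ≥ 0`.
The equivalence `typeG_iff_ineq` is EXACTLY a printed lemma, [MN02, Lemma 2.1 (i) ⇔ (iii) p. 323] (after
Rück 1990), for the reciprocal polynomial `t⁴·Q(1/t)`; proved here from first principles.
[cite: BrumerEtAl2019, Prop 4.3.2 p. 1168]
[MN02] = D. Maisner, E. Nart, *Abelian surfaces over finite fields as Jacobians* (with an appendix by E. W. Howe), Experiment. Math. **11**:3 (2002) 321–337 [cite: MaisnerNart2002]: **Lemma 2.1 p. 323** ("We review results of Rück and Xing …"): for a monic `f(t) = t⁴ + a₁t³ + a₂t² + qa₁t + q² ∈ ℤ[t]`, (i) all roots of `f` are `q`-Weil numbers (`|π| = √q`) ⇔ (iii) `|a₁| ≤ 4√q` and `2|a₁|√q − 2q ≤ a₂ ≤ a₁²/4 + 2q`.  Dictionary: `q = p`, `f(t) = t⁴·Q(1/t)`,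 `a₁ = −a`, `a₂ = b`, roots `π = 1/z`; `|a₁| ≤ 4√q ⇔ a² ≤ 16p`, `a₂ ≤ a₁²/4 + 2q ⇔ a² − 4b + 8p ≥ 0`, `2|a₁|√q − 2q ≤ a₂ ⇔ (2p + b ≥ 0 ∧ 4a²p ≤ (2p + b)²)`.
-/

open Polynomial Complex ComplexConjugate

namespace Literature.NumberTheory.FaltingsSerre

/-- Step 1 of the converse.  If every complex root `z` of `1 − az + bz² − paz³ + p²z⁴` has `‖z‖² = 1/p`,
then every complex root `y` of the trace quadratic `y² − ay + (b − 2p)` is real with `y² ≤ 4p`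
(take a root `z` of `pz² − yz + 1`; then `Q(z) = z²·0 = 0`, `1/z = p z̄`, `y = pz + 1/z = 2p Re z`) —
(i) ⇒ (ii) of [MN02, Lemma 2.1]. [cite: MaisnerNart2002, Lemma 2.1 p. 323] -/
theorem traceRoot_real_of_typeG {p : ℕ} (hp : 0 < p) {a b : ℤ}
    (h : ∀ z : ℂ, 1 - (a : ℂ) * z + (b : ℂ) * z ^ 2 - (p : ℂ) * (a : ℂ) * z ^ 3 + (p : ℂ) ^ 2 * z ^ 4 = 0 →
      ‖z‖ ^ 2 = (p : ℝ)⁻¹)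
    {y : ℂ} (hy : y ^ 2 - (a : ℂ) * y + ((b : ℂ) - 2 * p) = 0) :
    ∃ y₀ : ℝ, y = y₀ ∧ y₀ ^ 2 ≤ 4 * p := by
  have hpR : (0 : ℝ) < p := by exact_mod_cast hp
  have hpC : (p : ℂ) ≠ 0 := by exact_mod_cast hp.ne'
  -- a root `z` of `p z² − y z + 1`
  obtain ⟨t, ht⟩ := IsAlgClosed.exists_eq_mul_self (y ^ 2 - 4 * (p : ℂ))
  obtain ⟨z, h2z⟩ : ∃ z : ℂ, 2 * (p : ℂ) * z = y + t := ⟨(y + t) / (2 * p), by field_simp⟩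
  have hq : (p : ℂ) * z ^ 2 - y * z + 1 = 0 := by
    have h4 : (4 * (p : ℂ)) * ((p : ℂ) * z ^ 2 - y * z + 1) = 0 := by
      linear_combination (2 * (p : ℂ) * z - y + t) * h2z - ht
    exact (mul_eq_zero.1 h4).resolve_left (mul_ne_zero (by norm_num) hpC)
  have hz0 : z ≠ 0 := by
    intro h0
    rw [h0] at hq
    norm_num at hq
  have hzi : z⁻¹ = y - (p : ℂ) * z := by
    refine inv_eq_of_mul_eq_one_right ?_
    linear_combination (-1 : ℂ) * hq
  have hyz : y = (p : ℂ) * z + z⁻¹ := by rw [hzi]; ring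
  have hL : 1 - (a : ℂ) * z + (b : ℂ) * z ^ 2 - (p : ℂ) * (a : ℂ) * z ^ 3 + (p : ℂ) ^ 2 * z ^ 4 = 0 := by
    have key : z ^ 2 * (y ^ 2 - (a : ℂ) * y + ((b : ℂ) - 2 * p)) =
        1 - (a : ℂ) * z + (b : ℂ) * z ^ 2 - (p : ℂ) * (a : ℂ) * z ^ 3 + (p : ℂ) ^ 2 * z ^ 4 := by
      rw [hyz]
      field_simp
      ring
    rw [← key, hy, mul_zero]
  have hnsq : Complex.normSq z = (p : ℝ)⁻¹ := by rw [Complex.normSq_eq_norm_sq]; exact h z hL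
  have hinv : z⁻¹ = (p : ℂ) * conj z := by
    rw [Complex.inv_def, hnsq, inv_inv, mul_comm]
    norm_cast
  refine ⟨2 * p * z.re, ?_, ?_⟩
  · rw [hyz, hinv, ← mul_add, Complex.add_conj]
    push_cast
    ring
  · have hre : z.re * z.re ≤ (p : ℝ)⁻¹ := hnsq ▸ Complex.re_sq_le_normSq z
    have hpz : (p : ℝ) * (z.re * z.re) ≤ 1 := by
      calc (p : ℝ) * (z.re * z.re) ≤ p * (p : ℝ)⁻¹ := by gcongr
        _ = 1 := mul_inv_cancel₀ hpR.ne'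
    nlinarith [hpz, hpR]

/-- **The four inequalities are necessary.**  If `p > 0` and every complex root of
`1 − az + bz² − paz³ + p²z⁴` has `‖z‖² = 1/p`, then `a² − 4b + 8p ≥ 0`, `a² ≤ 16p`, `2p + b ≥ 0` and
`4a²p ≤ (2p + b)²` (Vieta for the trace quadratic: `y₁ + y₂ = a`, `y₁y₂ = b − 2p` with `yᵢ` real,
`yᵢ² ≤ 4p`) — (ii) ⇒ (iii) of [MN02, Lemma 2.1]. [cite: MaisnerNart2002, Lemma 2.1 p. 323] -/
theorem ineq_of_norm_sq_eq_inv {p : ℕ} (hp : 0 < p) {a b : ℤ}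
    (h : ∀ z : ℂ, 1 - (a : ℂ) * z + (b : ℂ) * z ^ 2 - (p : ℂ) * (a : ℂ) * z ^ 3 + (p : ℂ) ^ 2 * z ^ 4 = 0 →
      ‖z‖ ^ 2 = (p : ℝ)⁻¹) :
    0 ≤ a ^ 2 - 4 * b + 8 * p ∧ a ^ 2 ≤ 16 * p ∧ 0 ≤ 2 * p + b ∧
      4 * a ^ 2 * p ≤ (2 * p + b) ^ 2 := by
  -- the two roots `(a ± s)/2` of the trace quadratic, `s² = a² − 4(b − 2p)`
  obtain ⟨s, hs⟩ := IsAlgClosed.exists_eq_mul_self ((a : ℂ) ^ 2 - 4 * ((b : ℂ) - 2 * p))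
  have hy₁ : (((a : ℂ) + s) / 2) ^ 2 - (a : ℂ) * (((a : ℂ) + s) / 2) + ((b : ℂ) - 2 * p) = 0 := by
    linear_combination (-1 / 4 : ℂ) * hs
  have hy₂ : (((a : ℂ) - s) / 2) ^ 2 - (a : ℂ) * (((a : ℂ) - s) / 2) + ((b : ℂ) - 2 * p) = 0 := by
    linear_combination (-1 / 4 : ℂ) * hs
  obtain ⟨y₁, hy₁e, hy₁b⟩ := traceRoot_real_of_typeG hp h hy₁
  obtain ⟨y₂, hy₂e, hy₂b⟩ := traceRoot_real_of_typeG hp h hy₂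
  -- Vieta, transported to `ℝ`
  have hsumC : ((a : ℝ) : ℂ) = (y₁ : ℂ) + (y₂ : ℂ) := by
    rw [← hy₁e, ← hy₂e]; push_cast; ring
  have hprodC : (((b : ℝ) - 2 * p : ℝ) : ℂ) = (y₁ : ℂ) * (y₂ : ℂ) := by
    rw [← hy₁e, ← hy₂e]; push_cast
    linear_combination (-1 / 4 : ℂ) * hs
  have hsum : (a : ℝ) = y₁ + y₂ := by exact_mod_cast hsumC
  have hprod : (b : ℝ) - 2 * p = y₁ * y₂ := by exact_mod_cast hprodC
  have hpR : (0 : ℝ) < p := by exact_mod_cast hp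
  -- the four inequalities over `ℝ`, then back to `ℤ`
  have i₁ : (0 : ℝ) ≤ (a : ℝ) ^ 2 - 4 * b + 8 * p := by
    have : (a : ℝ) ^ 2 - 4 * b + 8 * p = (y₁ - y₂) ^ 2 := by rw [hsum]; linarith [hprod]
    rw [this]; positivity
  have i₂ : (a : ℝ) ^ 2 ≤ 16 * p := by rw [hsum]; nlinarith [sq_nonneg (y₁ - y₂)]
  have i₃ : (0 : ℝ) ≤ 2 * p + b := by nlinarith [sq_nonneg (y₁ + y₂)]
  have i₄ : 4 * (a : ℝ) ^ 2 * p ≤ (2 * p + b) ^ 2 := by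
    have hb : (b : ℝ) = y₁ * y₂ + 2 * p := by linarith
    rw [hsum, hb]
    nlinarith [mul_nonneg (sub_nonneg.2 hy₁b) (sub_nonneg.2 hy₂b)]
  refine ⟨?_, ?_, ?_, ?_⟩ <;> (first | exact_mod_cast i₁ | exact_mod_cast i₂ | exact_mod_cast i₃ |
    exact_mod_cast i₄)

/-- **Type (G) at `p` for an integer surface-shaped polynomial is equivalent to the four integer
inequalities** (`typeG_of_ineq` and `ineq_of_norm_sq_eq_inv`): for `p > 0`,
`(∀ z, Q(z) = 0 → |z| = p^{−1/2}) ↔ a² − 4b + 8p ≥ 0 ∧ a² ≤ 16p ∧ 2p + b ≥ 0 ∧ 4a²p ≤ (2p + b)²`,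
`Q = lPolynomialOfSurface p a b`.  Hence the hypothesis `hG` of [BPPTVY, Thm 4.3.4] ("`f` is of type (G)"
[Prop 4.3.2]) at a good prime is decided by `norm_num` on `(a_p(f), b_p(f))`, and cannot be discharged
otherwise.  This is [MN02, Lemma 2.1 (i) ⇔ (iii) p. 323] for `f(t) = t⁴·Q(1/t)` (`q = p`, `a₁ = −a`, `a₂ = b`).
[cite: MaisnerNart2002, Lemma 2.1 p. 323] [cite: BrumerEtAl2019, Prop 4.3.2 p. 1168; Thm 4.3.4 p. 1169] -/
theorem typeG_iff_ineq {p : ℕ} (hp : 0 < p) (a b : ℤ) :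
    (∀ z : ℂ, ((lPolynomialOfSurface p a b).map (Int.castRingHom ℂ)).IsRoot z → ‖z‖ = (Real.sqrt p)⁻¹) ↔
      (0 ≤ a ^ 2 - 4 * b + 8 * p ∧ a ^ 2 ≤ 16 * p ∧ 0 ≤ 2 * p + b ∧
        4 * a ^ 2 * p ≤ (2 * p + b) ^ 2) := by
  constructor
  · intro hG
    apply ineq_of_norm_sq_eq_inv hp
    intro z hz
    have hroot : ((lPolynomialOfSurface p a b).map (Int.castRingHom ℂ)).IsRoot z := by
      simp only [IsRoot.def, eval_map, lPolynomialOfSurface, eval₂_add, eval₂_sub, eval₂_one, eval₂_mul,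
        eval₂_C, eval₂_X, eval₂_X_pow]
      simp only [eq_intCast, Int.cast_mul, Int.cast_pow, Int.cast_natCast]
      linear_combination hz
    have hn := hG z hroot
    rw [hn, inv_pow, Real.sq_sqrt (by exact_mod_cast hp.le)]
  · rintro ⟨h₁, h₂, h₃, h₄⟩ z hz
    exact typeG_of_ineq hp h₁ h₂ h₃ h₄ z hz

/-- Sanity instance of the necessity: for `p = 3`, `(a, b) = (7, 1)` the second inequality fails
(`49 > 48`: `|a₁| > 4√q` in [MN02, Lemma 2.1 (iii)]), so `1 − 7T + T² − 21T³ + 9T⁴` is NOT of type (G)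
at `3`. [cite: MaisnerNart2002, Lemma 2.1 p. 323] -/
example : ¬ ∀ z : ℂ, ((lPolynomialOfSurface 3 7 1).map (Int.castRingHom ℂ)).IsRoot z →
    ‖z‖ = (Real.sqrt (3 : ℕ))⁻¹ := by
  rw [typeG_iff_ineq (by norm_num) 7 1]
  norm_num

end Literature.NumberTheory.FaltingsSerre
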